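import Mathlib
import Summits.ResolutionOfSingularities.ResolutionOfSingularities.Theorems.PAlterationAssemblyReduction
import Literature.AlgebraicGeometry.Resolution.ResolutionOfSingularities

/-!
# `PAlteration.PicoverToRadicialBottom`, line `theta-finite-cofinite-roots`: reduced pull-back transfer

Route `ResolutionOfSingularities/PAlteration`, crux `PicoverToRadicialBottom`
(stmt-ResolutionOfSingularities-0556), stub `stub_reducedPullbackTransfer` of the lead's skeleton
`work/PicoverToRadicialBottom.lean`, PROVED here (statement verbatim from the registration).

**Statement.** For `h : X ⟶ S` finite, universally injective and surjective, and `ρ : Y ⟶ S`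
proper and birational (`X`, `Y` integral), the composite `(X ×_S Y)_red ⟶ X ×_S Y ⟶ X` of the
inclusion of the reduced closed subscheme with the first projection is birational.

**Proof.** Let `U ⊆ S` be a dense open with dense preimage `ρ⁻¹ U ⊆ Y` over which `ρ` is an
isomorphism, and put `U' := h⁻¹ U`. Since `h` and its base change `snd : X ×_S Y ⟶ Y` are
finite, universally injective and surjective, they are homeomorphisms, and so is the inclusion
`ι : (X ×_S Y)_red ⟶ X ×_S Y`; hence `U' = h⁻¹ U` and `(ι ≫ fst)⁻¹ U' = (ι ≫ snd)⁻¹ (ρ⁻¹ U)` are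
dense. Finally `(ι ≫ fst) ∣_ U' = ι ∣_ (fst⁻¹ U') ≫ fst ∣_ U'`, where `fst ∣_ U'` is a base
change of the isomorphism `ρ ∣_ U` (restricting the cartesian square `X ×_S Y` over the open
`U`), and `ι ∣_ (fst⁻¹ U')` is an isomorphism because the open `fst⁻¹ U' ≅ U' ⊆ X` is reduced.
-/

noncomputable section

-- single-problem summit: the doubled namespace component `ResolutionOfSingularities` is forced
set_option linter.dupNamespace false

open CategoryTheory CategoryTheory.Limits AlgebraicGeometry TopologicalSpace Opposite
open Literature.AlgebraicGeometry.Resolution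
open Scheme.IdealSheafData

namespace Summit.ResolutionOfSingularities.ResolutionOfSingularities.Theorems

/-- **Reduced pull-back transfer of birationality.** For `h : X ⟶ S` finite, universally
injective and surjective and `ρ : Y ⟶ S` proper birational (`X`, `Y` integral), the reduced
fibre product `(X ×_S Y)_red ⟶ X` is birational: over `U' := h⁻¹ U` (`U ⊆ S` a dense open over
which `ρ` is an isomorphism) it is the composite of the restriction of the reduction map to the
reduced open `fst⁻¹ U' ≅ U'` with a base change of `ρ ∣_ U`; density of `U'` and of its preimage
holds because `h`, its base change and the reduction map are homeomorphisms. [folklore] -/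
theorem stub_reducedPullbackTransfer : ∀ (X S Y : Scheme.{0}) (h : X ⟶ S) (ρ : Y ⟶ S)
    [IsIntegral X] [IsIntegral Y] [IsFinite h] [UniversallyInjective h] [Surjective h]
    [IsProper ρ], IsBirational ρ →
    IsBirational ((vanishingIdeal (⊤ : Closeds ↑(pullback h ρ))).subschemeι ≫ pullback.fst h ρ) := by
  intro X S Y h ρ _ _ _ _ _ _ hρ
  obtain ⟨U, hU, hU', hiso⟩ := hρ
  -- `h`, its base change `snd` and the reduction map `ι` are homeomorphisms
  have hh : IsHomeomorph h.base :=
    isHomeomorph_of_isFinite_of_universallyInjective_of_surjective h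
  have hsnd : IsHomeomorph (pullback.snd h ρ).base :=
    isHomeomorph_of_isFinite_of_universallyInjective_of_surjective (pullback.snd h ρ)
  have hι : IsHomeomorph (vanishingIdeal (⊤ : Closeds ↑(pullback h ρ))).subschemeι.base :=
    isHomeomorph_subschemeι_vanishingIdeal_top
  refine ⟨h ⁻¹ᵁ U, hU.preimage hh.isOpenMap, ?_, ?_⟩
  · -- `(ι ≫ fst)⁻¹ (h⁻¹ U) = (ι ≫ snd)⁻¹ (ρ⁻¹ U)` is dense
    have hpre : ((vanishingIdeal (⊤ : Closeds ↑(pullback h ρ))).subschemeι ≫ pullback.fst h ρ) ⁻¹ᵁ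
        (h ⁻¹ᵁ U) =
        ((vanishingIdeal (⊤ : Closeds ↑(pullback h ρ))).subschemeι ≫ pullback.snd h ρ) ⁻¹ᵁ
          (ρ ⁻¹ᵁ U) := by
      rw [← Scheme.Hom.comp_preimage, ← Scheme.Hom.comp_preimage, Category.assoc,
        Category.assoc, pullback.condition]
    have hcomp :
        IsHomeomorph ((vanishingIdeal (⊤ : Closeds ↑(pullback h ρ))).subschemeι ≫
          pullback.snd h ρ).base := by
      rw [Scheme.Hom.comp_base, TopCat.coe_comp]
      exact hsnd.comp hι
    rw [hpre]
    exact hU'.preimage hcomp.isOpenMap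
  · -- `(ι ≫ fst) ∣_ (h⁻¹ U) = ι ∣_ (fst⁻¹ h⁻¹ U) ≫ fst ∣_ (h⁻¹ U)`, both isomorphisms
    haveI := hiso
    -- `fst ∣_ (h⁻¹ U)` is a base change of the isomorphism `ρ ∣_ U`
    have t := (isPullback_morphismRestrict ρ U).flip
    have s := (isPullback_morphismRestrict (pullback.fst h ρ) (h ⁻¹ᵁ U)).flip.paste_horiz
      (IsPullback.of_hasPullback h ρ).flip
    rw [← morphismRestrict_ι h U] at s
    haveI hfst : IsIso (pullback.fst h ρ ∣_ h ⁻¹ᵁ U) :=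
      (IsPullback.of_right' s t).isIso_snd_of_isIso
    -- the open `fst⁻¹ h⁻¹ U ≅ h⁻¹ U ⊆ X` is reduced, so `ι` is an isomorphism over it
    haveI : IsReduced (↑(pullback.fst h ρ ⁻¹ᵁ (h ⁻¹ᵁ U)) : Scheme.{0}) :=
      isReduced_of_isOpenImmersion (pullback.fst h ρ ∣_ (h ⁻¹ᵁ U))
    have hιU : IsIso ((vanishingIdeal (⊤ : Closeds ↑(pullback h ρ))).subschemeι ∣_
        (pullback.fst h ρ ⁻¹ᵁ (h ⁻¹ᵁ U))) :=
      isIso_subschemeι_vanishingIdeal_top_morphismRestrict _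
    rw [morphismRestrict_comp]
    exact IsIso.comp_isIso' hιU hfst

end Summit.ResolutionOfSingularities.ResolutionOfSingularities.Theorems

end
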